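import Summits.BirchSwinnertonDyer.Rank1Residual.GaloisImage.ThreeLagrangianLemma
import Mathlib.LinearAlgebra.Dual.Lemmas
import Mathlib.Algebra.Field.ZMod
import Mathlib.SetTheory.Cardinal.Finite
import HarnessLib

/-!
# The three-Lagrangian lemma, II: the Lagrangians transverse to a fixed Lagrangian `W` of a
# non-degenerate symmetric `4`-space form a `K`-TORSOR — there are `#K` of them, THREE over `𝔽₃`
# (cell `b2b-bsdres`, team n1011, seat p02 gen 9 — TOOL file; row T-K43-TOOL = r1 ROUTE-1 §43.1
# LEMMA 43.1 (b) typed once; lead R5-86 (l); skeleton `cells/n1011/skel/T-K43.md`)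

HONEST FRAMING (cell `b2b-bsdres`, run/shared/lean/b2b/bsd-rank1-residual/, verbatim in every
file): the goal of the cell is to DELETE the COMBINATION-SHAPED residual classes of the
Birch–Swinnerton-Dyer formula for ALL analytic-rank `≤ 1` elliptic curves over `ℚ` — "full BSD
formula for every rank `≤ 1` curve in class `C`" assembled STRICTLY from published theorems — so
that the rank-`≤ 1` remainder becomes exactly the CONSTRUCTION-SHAPED classes, which are TYPED
(missing-input `Prop`s), NOT attempted. This is not "finishing BSD". Team n1011 (N10 / N11, the
additive block `X4 ∧ p = 3`): research route; no claim beyond the stated classes; labels UNCHANGED;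
nothing is booked. Theorems only (no definition, no named fact); a TOOL file of pure linear algebra.

## Setting (as in `ThreeLagrangianLemma.lean`)

`K` a field with `[NeZero (2 : K)]`; `B : LinearMap.BilinForm K V` with `hB : B.Nondegenerate`,
`hBs : B.IsSymm` (the currency of PART A, p12's `LagrangianComplementDichotomy.lean`); "isotropic `L`"
means `∀ x ∈ L, ∀ y ∈ L, B x y = 0`; graphs `Γ_g` are written inline as
`LinearMap.range (Λ₀.subtype + W.subtype ∘ₗ g)`.

## What this file proves (r1 ROUTE-1 §43.1, LEMMA 43.1 (b))

* §1 `exists_alternating_graph_apply_eq` — the pairing `Λ₀ × W → K` induced by `B` is perfect when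
  `Λ₀ ⊕ W = V`, `W` is isotropic and `dim W = dim Λ₀` (`ψ : W → Λ₀^∨, w ↦ B(·, w)` is injective by
  non-degeneracy, onto by dimension), so for a basis `b₀, b₁` of the plane `Λ₀` and any `c : K`
  there is `g : Λ₀ →ₗ W` with `B_g` ALTERNATING and `B b₀ (g b₁) = c`;
  `natCard_alternatingGraphMaps_eq` — `g ↦ B b₀ (g b₁)` is a bijection
  `{g : B_g alternating} ≃ K` (injective by the engine of file I), so `Nat.card {g} = Nat.card K`.
* §2 **`natCard_transverseLagrangians_eq`** — in a non-degenerate symmetric `4`-space over a field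
  with `2 ≠ 0`, given an isotropic `2`-plane `W` and ONE isotropic `2`-plane `Λ₀` with `Λ₀ ⊓ W = ⊥`,
  the set of ALL isotropic `2`-planes `Λ` with `Λ ⊓ W = ⊥` has `Nat.card = Nat.card K` (by (a) of
  file I they are the graphs of the alternating `g`); **`natCard_transverseLagrangians_eq_three`** —
  over `ZMod 3` there are EXACTLY THREE ("a Lagrangian transverse to `W` is one of exactly three",
  r1 §43.1 (b): `Λ₀, Γ_{g₀}, Γ_{−g₀}`).

Not proved: existence of a transverse Lagrangian from hyperbolicity alone (Witt) — one base `Λ₀`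
is an input (in the cohomological application `Λ₀ = L_E`).
-/

open Module Submodule

namespace Summit.BirchSwinnertonDyer.Rank1Residual.GaloisImage.ThreeLagrangian

variable {K V : Type*} [Field K] [AddCommGroup V] [Module K V]

/-! ## §1 Alternating graph maps `Λ₀ → W` are parametrised by `K` -/

section Alternating

variable (B : LinearMap.BilinForm K V) {Λ₀ W : Submodule K V}

/-- **The pairing `Λ₀ × W → K` is perfect; alternating graph maps with prescribed entry exist.**
`Λ₀ ⊕ W = V`, `W` isotropic, `dim W = dim Λ₀`, `B` symmetric non-degenerate, `b` a basis of the
plane `Λ₀`: for every `c : K` there is `g : Λ₀ →ₗ W` with `B x (g x) = 0` for all `x ∈ Λ₀` and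
`B (b 0) (g (b 1)) = c` (take `g b₀ = w₀, g b₁ = w₁` with `B(·, w₀) = −c·b₁^*`, `B(·, w₁) = c·b₀^*`
on `Λ₀`). [folklore] -/
theorem exists_alternating_graph_apply_eq [FiniteDimensional K V] (hB : B.Nondegenerate)
    (hc : IsCompl Λ₀ W)
    (hW : ∀ x ∈ W, ∀ y ∈ W, B x y = 0) (hfin : finrank K W = finrank K Λ₀)
    (b : Basis (Fin 2) K Λ₀) (c : K) :
    ∃ g : Λ₀ →ₗ[K] W, (∀ x : Λ₀, B (x : V) (g x : V) = 0) ∧ B (b 0 : V) (g (b 1) : V) = c := by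
  -- `ψ w = B(·, w)|_{Λ₀}`
  let ψ : W →ₗ[K] Module.Dual K Λ₀ := (B.domRestrict Λ₀).flip ∘ₗ W.subtype
  have hψ : ∀ (w : W) (x : Λ₀), ψ w x = B (x : V) (w : V) := fun w x ↦ rfl
  have hψinj : Function.Injective ψ := by
    intro w w' hww'
    have h0 : ψ (w - w') = 0 := by rw [map_sub, hww', sub_self]
    have horth : ∀ x ∈ Λ₀, B x ((w - w' : W) : V) = 0 := fun x hx ↦ by
      have := LinearMap.congr_fun h0 ⟨x, hx⟩
      rwa [hψ, LinearMap.zero_apply] at this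
    have hall : ∀ v, B v ((w - w' : W) : V) = 0 :=
      forall_apply_eq_zero_of_forall_mem B hc hW (w - w').2 horth
    have : ((w - w' : W) : V) = 0 := hB.2 _ hall
    have : w - w' = 0 := by exact_mod_cast this
    exact sub_eq_zero.mp this
  have hψsurj : Function.Surjective ψ :=
    (LinearMap.injective_iff_surjective_of_finrank_eq_finrank
      (hfin.trans (Subspace.dual_finrank_eq (K := K) (V := Λ₀)).symm)).mp hψinj
  obtain ⟨w₀, hw₀⟩ := hψsurj (-c • b.coord 1)
  obtain ⟨w₁, hw₁⟩ := hψsurj (c • b.coord 0)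
  refine ⟨b.constr K ![w₀, w₁], fun x ↦ ?_, ?_⟩
  · have hgx : (b.constr K ![w₀, w₁] : Λ₀ → W) x = b.repr x 0 • w₀ + b.repr x 1 • w₁ := by
      rw [Basis.constr_apply_fintype, Fin.sum_univ_two]
      simp only [Basis.equivFun_apply, Matrix.cons_val_zero, Matrix.cons_val_one]
    rw [hgx, Submodule.coe_add, Submodule.coe_smul, Submodule.coe_smul, map_add, map_smul,
      map_smul, ← hψ w₀ x, ← hψ w₁ x, hw₀, hw₁]
    simp only [LinearMap.smul_apply, Basis.coord_apply, smul_eq_mul]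
    ring
  · rw [Basis.constr_basis]
    simp only [Matrix.cons_val_one, Matrix.cons_val_zero]
    rw [← hψ w₁ (b 0), hw₁, LinearMap.smul_apply, Basis.coord_apply, b.repr_self_apply]
    simp

/-- **`{g : Λ₀ →ₗ W | B_g alternating} ≃ K` via `g ↦ B b₀ (g b₁)`**: injective by the engine
`graph_eq_zero_of_skew_of_apply_basis_eq_zero` applied to a difference, onto by
`exists_alternating_graph_apply_eq`; hence the cardinalities agree. [folklore] -/
theorem natCard_alternatingGraphMaps_eq [FiniteDimensional K V] [NeZero (2 : K)]
    (hB : B.Nondegenerate) (hc : IsCompl Λ₀ W)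
    (hW : ∀ x ∈ W, ∀ y ∈ W, B x y = 0) (hfin : finrank K W = finrank K Λ₀)
    (b : Basis (Fin 2) K Λ₀) :
    Nat.card {g : Λ₀ →ₗ[K] W // ∀ x : Λ₀, B (x : V) (g x : V) = 0} = Nat.card K := by
  refine Nat.card_congr (Equiv.ofBijective
    (fun g : {g : Λ₀ →ₗ[K] W // ∀ x : Λ₀, B (x : V) (g x : V) = 0} ↦ B (b 0 : V) (g.1 (b 1) : V))
    ⟨?_, ?_⟩)
  · rintro ⟨g, hg⟩ ⟨g', hg'⟩ hγ
    simp only at hγ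
    have hskew := (skew_iff_alternating B g).mpr hg
    have hskew' := (skew_iff_alternating B g').mpr hg'
    have hd : g - g' = 0 := by
      refine graph_eq_zero_of_skew_of_apply_basis_eq_zero B hB hc hW b (g - g')
        (fun x y ↦ ?_) ?_
      · simp only [LinearMap.sub_apply, Submodule.coe_sub, map_sub]
        linear_combination hskew x y - hskew' x y
      · simp only [LinearMap.sub_apply, Submodule.coe_sub, map_sub]
        rw [hγ, sub_self]
    exact Subtype.ext (sub_eq_zero.mp hd)
  · intro c
    obtain ⟨g, hg, hc'⟩ := exists_alternating_graph_apply_eq B hB hc hW hfin b c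
    exact ⟨⟨g, hg⟩, hc'⟩

end Alternating

/-! ## §2 (b) The transverse Lagrangians are a `K`-torsor -/

section Count

variable (B : LinearMap.BilinForm K V) {W Λ₀ : Submodule K V}

/-- **LEMMA 43.1 (b): there are exactly `#K` Lagrangians transverse to `W`.** Over a field with
`2 ≠ 0`, in a `4`-space with a symmetric non-degenerate bilinear form, let `W` be an isotropic
`2`-plane and `Λ₀` ONE isotropic `2`-plane with `Λ₀ ⊓ W = ⊥`. Then the isotropic `2`-planes `Λ`
with `Λ ⊓ W = ⊥` are in bijection with the alternating graph maps `g : Λ₀ →ₗ W` (`Λ = Γ_g`,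
file I (a)), hence with `K`: `Nat.card {Λ} = Nat.card K`. (For infinite `K` both sides are the junk
value `0`; the content is the bijection.) [folklore] -/
theorem natCard_transverseLagrangians_eq [NeZero (2 : K)] (hB : B.Nondegenerate) (hBs : B.IsSymm)
    (h4 : finrank K V = 4)
    (hW2 : finrank K W = 2) (hΛ₀2 : finrank K Λ₀ = 2)
    (hW : ∀ x ∈ W, ∀ y ∈ W, B x y = 0) (hΛ₀ : ∀ x ∈ Λ₀, ∀ y ∈ Λ₀, B x y = 0) (hΛ₀W : Λ₀ ⊓ W = ⊥) :
    Nat.card {Λ : Submodule K V //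
      finrank K Λ = 2 ∧ (∀ x ∈ Λ, ∀ y ∈ Λ, B x y = 0) ∧ Λ ⊓ W = ⊥} = Nat.card K := by
  haveI : FiniteDimensional K V := Module.finite_of_finrank_eq_succ h4
  haveI : Module.Finite K Λ₀ := Module.finite_of_finrank_eq_succ hΛ₀2
  have hc : IsCompl Λ₀ W :=
    (Submodule.isCompl_iff_disjoint Λ₀ W (by rw [h4, hΛ₀2, hW2])).mpr (disjoint_iff.mpr hΛ₀W)
  let b : Basis (Fin 2) K Λ₀ := Module.finBasisOfFinrankEq K Λ₀ hΛ₀2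
  rw [← natCard_alternatingGraphMaps_eq B hB hc hW (hW2.trans hΛ₀2.symm) b]
  -- the bijection `Λ ↦ g_Λ` (file I (a)) with inverse `g ↦ Γ_g`
  have hex : ∀ Λ : {Λ : Submodule K V //
      finrank K Λ = 2 ∧ (∀ x ∈ Λ, ∀ y ∈ Λ, B x y = 0) ∧ Λ ⊓ W = ⊥},
      ∃! g : Λ₀ →ₗ[K] W, LinearMap.range (Λ₀.subtype + W.subtype ∘ₗ g) = Λ.1 := fun Λ ↦
    existsUnique_graph_range_eq hc Λ.1 Λ.2.2.2 (Λ.2.1.trans hΛ₀2.symm)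
  refine Nat.card_congr
    { toFun := fun Λ ↦ ⟨(hex Λ).exists.choose, (skew_iff_alternating B _).mp
        ((isotropic_range_graph_iff_skew B hBs hΛ₀ hW _).mp ?_)⟩
      invFun := fun g ↦ ⟨LinearMap.range (Λ₀.subtype + W.subtype ∘ₗ g.1),
        (finrank_range_graph hΛ₀W g.1).trans hΛ₀2,
        (isotropic_range_graph_iff_skew B hBs hΛ₀ hW g.1).mpr
          ((skew_iff_alternating B g.1).mpr g.2),
        range_graph_inf_eq_bot hΛ₀W g.1⟩
      left_inv := fun Λ ↦ Subtype.ext (hex Λ).exists.choose_spec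
      right_inv := fun g ↦ Subtype.ext ((hex ⟨LinearMap.range (Λ₀.subtype + W.subtype ∘ₗ g.1),
        (finrank_range_graph hΛ₀W g.1).trans hΛ₀2,
        (isotropic_range_graph_iff_skew B hBs hΛ₀ hW g.1).mpr
          ((skew_iff_alternating B g.1).mpr g.2),
        range_graph_inf_eq_bot hΛ₀W g.1⟩).unique (hex _).exists.choose_spec rfl) }
  rw [(hex Λ).exists.choose_spec]
  exact Λ.2.2.1

/-- **"A Lagrangian transverse to `W` is one of EXACTLY THREE"** (r1 ROUTE-1 §43.1 (b) over `𝔽₃`):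
in a `4`-dimensional `ZMod 3`-space with a symmetric non-degenerate bilinear form, given an
isotropic `2`-plane `W` and one isotropic `2`-plane `Λ₀` with `Λ₀ ⊓ W = ⊥`, there are exactly `3`
isotropic `2`-planes `Λ` with `Λ ⊓ W = ⊥` (namely `Λ₀ = Γ_0, Γ_{g₀}, Γ_{−g₀}`). [folklore] -/
theorem natCard_transverseLagrangians_eq_three {V : Type*} [AddCommGroup V] [Module (ZMod 3) V]
    (B : LinearMap.BilinForm (ZMod 3) V) {W Λ₀ : Submodule (ZMod 3) V}
    (hB : B.Nondegenerate) (hBs : B.IsSymm) (h4 : finrank (ZMod 3) V = 4)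
    (hW2 : finrank (ZMod 3) W = 2) (hΛ₀2 : finrank (ZMod 3) Λ₀ = 2)
    (hW : ∀ x ∈ W, ∀ y ∈ W, B x y = 0) (hΛ₀ : ∀ x ∈ Λ₀, ∀ y ∈ Λ₀, B x y = 0) (hΛ₀W : Λ₀ ⊓ W = ⊥) :
    Nat.card {Λ : Submodule (ZMod 3) V //
      finrank (ZMod 3) Λ = 2 ∧ (∀ x ∈ Λ, ∀ y ∈ Λ, B x y = 0) ∧ Λ ⊓ W = ⊥} = 3 := by
  haveI : NeZero (2 : ZMod 3) := ⟨by decide⟩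
  have h := natCard_transverseLagrangians_eq B hB hBs h4 hW2 hΛ₀2 hW hΛ₀ hΛ₀W
  rwa [Nat.card_zmod] at h

end Count

end Summit.BirchSwinnertonDyer.Rank1Residual.GaloisImage.ThreeLagrangian
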